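import Summits.BirchSwinnertonDyer.Rank1Residual.GaloisImage.KuriharaRecordBSDpThreeLevelOneEndOfBaseRigidity
import Summits.BirchSwinnertonDyer.Rank1Residual.Additive.X4ThreeKuriharaEndM1Records11
import Summits.BirchSwinnertonDyer.Rank1Residual.Additive.X4ThreeKuriharaEndM1Records12
import HarnessLib

/-!
# N11 LOWER@3: END-m1 RECORDS, [S24]-FREE twins (`…_of_baseRigidity`) — series file BR8: `13680be1`, `15102c1`, `15129e1`
# (cell `b2b-bsdres`, team n1011, seat p03, OWNERS row T-R1-57-REC; twins of the landed
# `Additive/X4ThreeKuriharaEndM1Records*.lean` records through n1011-p18's [S24]-free ENDs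
# `GaloisImage/KuriharaRecordBSDpThreeLevelOneEndOfBaseRigidity.lean` (p292786) = n1011-p09's END-m1 over
# n1011-p11's BASE RIGIDITY `GaloisImage/KolyvaginBaseRigidity.lean` (R1-58, p290143); pattern = n1011-p18's
# pilot twin `bsdp3_endm1_v2718d1_of_baseRigidity`)

HONEST FRAMING (cell `b2b-bsdres`, run/shared/lean/b2b/bsd-rank1-residual/, verbatim in every
file): the goal of the cell is to DELETE the COMBINATION-SHAPED residual classes of the
Birch–Swinnerton-Dyer formula for ALL analytic-rank `≤ 1` elliptic curves over `ℚ` — "full BSD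
formula for every rank `≤ 1` curve in class `C`" assembled STRICTLY from published theorems — so
that the rank-`≤ 1` remainder becomes exactly the CONSTRUCTION-SHAPED classes, which are TYPED
(missing-input `Prop`s), NOT attempted. This is not "finishing BSD". Team n1011 (N10/N11, the
additive block `X4 ∧ p = 3`) is a RESEARCH ROUTE; no claim beyond the stated classes; the label X4 and
the mark of RESIDUAL-MAP §I N11 (LOWER@3) are UNCHANGED. **These records CLOSE NOTHING and move no
mark**: PER-PAIR record SHAPES, not a class theorem; EVIDENCE-grade booking CANDIDATES for the director,
nothing is booked by this file. END-m1 is DEBT REDUCTION, not coverage (`BSD(E,3)` only where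
`ord₃(L(E,1)/Ω_E) ≤ 2`).  Theorems only (no definition, no named fact minted).

## What this file does

For each row below, the twin `bsdp3_endm1_v<label>_of_baseRigidity` (and its LITERAL-model form
`…_of_eq_of_baseRigidity`) of the landed record `bsdp3_endm1_v<label>` with the interim NAMED FACT
`hS24` ([S24] Thm. 4.4 (1)) AND the binder `hunro` DELETED: the injectivity at the core vertex `∅` is
n1011-p11's BASE RIGIDITY (R1-58) through n1011-p09's `…_of_baseRigidity` END-m1 and n1011-p18's
`Assembly.bsdp_three_potMult_of_levelOneCertificates_of_baseRigidity` ((M) rows) /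
`Assembly.bsdp_three_of_towerSurj_of_levelOneCertificates_of_baseRigidity` (potentially good rows).
So on these rows the LOWER half of `BSD(E,3)` carries NO [S24] fact and NO four-class Chebotarev step;
what REMAINS ASSUMED is: the PORT `KatoKuriharaPortThreeAt W 0 v₃` (FLAG `K22-Thm3.13-PORT@3`), the
Poitou–Tate family `inv hperf hsum hcompl` + Tate's `hEP`, Cassels–Tate `hCT`, the UPPER-half named facts
`hKatoS hDel hmodD hKatoχ` (+ `hGZK hmod h26`), the EVIDENCE binders `hr` (`r_an = 0`), the optimal datum
`D`/`hopt`, and the three Kurihara VALUES in `hδ` (HYPOTHESES labelled EVIDENCE, two sources per value,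
named in the sibling series file's per-record docstring and in `b2b-bsdres-n1011-p03/ENDM1-RECORDS-INDEX.tsv`:
δ̃_n — engine 2 j128824 × ENG-D KFOLD / KURX blind AGREE as in the S2 record; δ̃_1 ≡ 0 (mod 3), ≢ 0
(mod 27) — Cremona `allbsd` via the register × engine 2's exact `L_over_OmegaE` / `v = 2`).  The kernel
inputs are reused BY NAME from the sibling file (`natCard_threeTorsion_v<label>`,
`isKolyvaginProduct_one_v<label>`, `forall_card_torsion_le_v<label>`) and the landed S2 / GaloisImage
records (`surj3_v` / `towerSurj3_v`, `tamagawaProduct_v`).  Nothing is booked; class X4 stays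
CONSTRUCTION-SHAPED; N11's mark is unchanged.

References: C.-H. Kim, AJM 148 (2026) Thm. 1.9 (6), Thm. 3.13 [Kim2022StructureSelmer]; K. Rubin, PCMI 18
(2011) Thm. 2.8.4 [Rubin2011]; B. Mazur, K. Rubin, Mem. AMS 799 (2004) [MazurRubin2004]; K. Kato, Astérisque
295 (2004) Thm. 14.5 (3) [Kato2004Asterisque]; D. Delbourgo (1998) Prop. 4 [Delbourgo1998]; Agashe–Ribet–Stein
(2006) Thm. 2.6 [AgasheRibetStein2006]; J. H. Silverman, AEC (2009) X.4.14 [SilvermanAEC2009]; R. L. Miller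
(2011) Def. 1.1 [Miller2011LMS]; cell files cells/n1011/ROUTE-1.md §33.3/§34.3, OWNERS.md (T-R1-57-B, R1-58,
T-R1-57-REC), `cells/n1011/skel/T-R1-57-REC.md`.
-/

set_option autoImplicit false

noncomputable section

open scoped Classical NumberField

open Function NumberField IsDedekindDomain WeierstrassCurve
  Literature.NumberTheory.EllipticCurves Literature.NumberTheory.EllipticCurves.ModularForms
  Literature.NumberTheory.EllipticCurves.Rank1Residual
  Literature.NumberTheory.EllipticCurves.AgasheRibetStein2006
  Literature.NumberTheory.GaloisRepresentations
  Literature.NumberTheory.GaloisRepresentations.DiscreteGaloisModule Literature.NumberTheory.GaloisCohomology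
  IsDedekindDomain.HeightOneSpectrum Rat.HeightOneSpectrum
  Summit.BirchSwinnertonDyer.BirchSwinnertonDyer.Rank1Residual.IntModel
  Summit.BirchSwinnertonDyer.Rank1Residual.GaloisImage Summit.BirchSwinnertonDyer.Rank1Residual.X4

namespace Summit.BirchSwinnertonDyer.Rank1Residual.Additive.X4ThreeKuriharaCert

/-! ### [S24]-free twin: `13680be1` (`N = 13680`, (M); level `n = 7·37 = 259`; sibling `X4ThreeKuriharaEndM1Records11`) -/

/-- **END-m1 RECORD `13680be1` at `n = 7·37 = 259`, [S24]-FREE (CLOSES NOTHING, moves no mark)** — the twin of the landed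
`bsdp3_endm1_v13680be1` (X4ThreeKuriharaEndM1Records11) with the interim NAMED FACT `hS24` and the binder `hunro` DELETED: injectivity at the core
vertex `∅` is n1011-p11's BASE RIGIDITY (R1-58) through n1011-p09's `…_of_baseRigidity` END-m1 and n1011-p18's
`Assembly.bsdp_three_potMult_of_levelOneCertificates_of_baseRigidity`. So on this row the LOWER half of `BSD(E,3)` carries NO [S24] fact and
NO four-class Chebotarev step; what REMAINS ASSUMED: the PORT `hPort` (FLAG `K22-Thm3.13-PORT@3`), the PT family
`inv hperf hsum hcompl` + `hEP`, `hCT`, the UPPER-half named facts, `hr`, the optimal datum `D`/`hopt`, and the THREE Kurihara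
VALUES in `hδ` (EVIDENCE, two sources per value — the sibling record's docstring / `ENDM1-RECORDS-INDEX.tsv`). Kernel inputs by
name: `natCard_threeTorsion_v13680be1`, `isKolyvaginProduct_one_v13680be1`, `forall_card_torsion_le_v13680be1`, `surj3_v13680be1`,
`tamagawaProduct_v13680be1`. CERTIFICATE-EVIDENCE record SHAPE; nothing booked; no class closed.
[cite: Kim2022StructureSelmer, Thm. 1.9 (6) and Thm. 3.13] [cite: Rubin2011, Thm. 2.8.4]
[cite: Kato2004Asterisque, Thm. 14.5 (3) (p. 236)] [cite: AgasheRibetStein2006, Thm. 2.6 (p. 619)] -/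
theorem bsdp3_endm1_v13680be1_of_baseRigidity
    -- UPPER half: the X4 chain of record; GZK; modularity; ARS 2.6; Cassels–Tate (NO [S24] fact)
    (hKatoS : Kato2004.rankZero_padicValNat_sha_le_sub_localTamagawa_of_additive_potGood_of_imageContainsSL2)
    (hDel : Delbourgo1998.prop4_rankZero_pow_dvd_constantCoeff)
    (hGZK : rank_eq_analyticRank_of_analyticRank_le_one) (hmod : hasEntireLFunction_rat)
    (hmodD : nonempty_modularParametrizationData)
    (hKatoχ : Wuthrich2014.kato_halfEigenCharIdeal_dvd_cyclotomicPrime_of_surjective)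
    (h26 : cremona_abs_maninConstant_eq_one_of_level_le)
    (hCT : exists_casselsTate_pairing (K := ℚ))
    -- the row
    {W : WeierstrassCurve ℚ} [W.IsElliptic] [W.IsGloballyMinimal]
    (hI : integralModelInt W = ⟨0, 0, 0, 1344237, -1275542062⟩)
    (hr : W.analyticRank = 0)
    (D : ModularParametrizationData W 13680)
    (hopt : ∀ z ∈ D.L.lattice, ∃ w ∈ periodLattice D.f, z = D.c * w)
    -- LOWER half: the Poitou–Tate family at `3` (NO `hunro`), Tate's local Euler characteristic, the ONE port
    (inv : LocalInvariants ℚ 3) (hperf : inv.IsPerfect) (hsum : inv.SumLocalTermEqZero)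
    (hcompl : inv.SelmerComplement)
    (hEP : ∀ v : HeightOneSpectrum (𝓞 ℚ), localEulerPoincareCharacteristic (v.adicCompletion ℚ))
    (v₃ : HeightOneSpectrum (𝓞 ℚ)) (hv₃ : ((3 : ℕ) : 𝓞 ℚ) ∈ v₃.asIdeal)
    (hPort : KatoKuriharaPortThreeAt W 0 v₃)
    -- the CERTIFICATE: THREE VALUES (EVIDENCE, two sources each — sibling file docstring / index)
    (hδ : ∃ (ψ : (ℓ : ℕ) → (ZMod ℓ)ˣ →* Multiplicative (ZMod (3 ^ 1)))
        (ψ₂₇ : (ℓ : ℕ) → (ZMod ℓ)ˣ →* Multiplicative (ZMod (3 ^ 3))),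
      (∀ ℓ ∈ (259 : ℕ).primeFactors, Function.Surjective (ψ ℓ)) ∧
        kuriharaNumber D.f (3 ^ 1) 259 ψ ≠ 0 ∧ kuriharaNumber D.f (3 ^ 1) 1 ψ = 0 ∧
        kuriharaNumber D.f (3 ^ 3) 1 ψ₂₇ ≠ 0) :
    BSDp W 3 := by
  haveI : Fact (Nat.Prime 3) := ⟨Nat.prime_three⟩
  haveI : NeZero (259 : ℕ) := ⟨by norm_num⟩
  obtain ⟨ψ, ψ₂₇, hψ, hcert, hzero₁, hunit₁⟩ := hδ
  have htam : ¬ 3 ∣ W.tamagawaProduct := by rw [tamagawaProduct_v13680be1 hI]; decide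
  have hc3 : ¬ 3 ∣ (W.baseChange ℚ_[3]).localTamagawaNumber ℤ_[3] := fun h =>
    htam (h.trans (localTamagawaNumber_padic_dvd_tamagawaProduct W 3))
  have hsurj : W.HasSurjectiveModNGaloisRep ((3 : ℕ) : ℤ) := by simpa using surj3_v13680be1 hI
  have hjneg : padicValRat 3 W.j < 0 :=
    padicValRat_j_neg_of_intModel hI 3 2 (by decide) (by decide)
  exact Assembly.bsdp_three_potMult_of_levelOneCertificates_of_baseRigidity hKatoS hDel hGZK hmod hmodD
    hKatoχ h26 hCT W hI (by decide +kernel) (by decide +kernel) hsurj hjneg hc3 (natCard_threeTorsion_v13680be1 W hI) hr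
    (by norm_num) D hopt inv hperf hsum hcompl hEP v₃ hv₃ hPort 259 (isKolyvaginProduct_one_v13680be1 hI)
    (forall_card_torsion_le_v13680be1 hI) ψ hψ hcert hzero₁ ψ₂₇ hunit₁

/-- **END-m1 RECORD `13680be1`, [S24]-FREE, on the LITERAL model `W = [0, 0, 0, 1344237, -1275542062]`** (pilot pattern: `hI` from `hW`; then
`bsdp3_endm1_v13680be1_of_baseRigidity`). Same hypotheses / EVIDENCE binders / framing; CLOSES NOTHING, nothing booked.
[cite: Kim2022StructureSelmer, Thm. 1.9 (6) and Thm. 3.13] [cite: SilvermanAEC2009, VII.1 Remark 1.1] -/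
theorem bsdp3_endm1_v13680be1_of_eq_of_baseRigidity
    -- UPPER half: the X4 chain of record; GZK; modularity; ARS 2.6; Cassels–Tate (NO [S24] fact)
    (hKatoS : Kato2004.rankZero_padicValNat_sha_le_sub_localTamagawa_of_additive_potGood_of_imageContainsSL2)
    (hDel : Delbourgo1998.prop4_rankZero_pow_dvd_constantCoeff)
    (hGZK : rank_eq_analyticRank_of_analyticRank_le_one) (hmod : hasEntireLFunction_rat)
    (hmodD : nonempty_modularParametrizationData)
    (hKatoχ : Wuthrich2014.kato_halfEigenCharIdeal_dvd_cyclotomicPrime_of_surjective)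
    (h26 : cremona_abs_maninConstant_eq_one_of_level_le)
    (hCT : exists_casselsTate_pairing (K := ℚ))
    -- the row (LITERAL model)
    (W : WeierstrassCurve ℚ) [W.IsElliptic] [W.IsGloballyMinimal]
    (hW : W = ⟨0, 0, 0, 1344237, -1275542062⟩)
    (hr : W.analyticRank = 0)
    (D : ModularParametrizationData W 13680)
    (hopt : ∀ z ∈ D.L.lattice, ∃ w ∈ periodLattice D.f, z = D.c * w)
    -- LOWER half: the Poitou–Tate family at `3` (NO `hunro`), Tate's local Euler characteristic, the ONE port
    (inv : LocalInvariants ℚ 3) (hperf : inv.IsPerfect) (hsum : inv.SumLocalTermEqZero)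
    (hcompl : inv.SelmerComplement)
    (hEP : ∀ v : HeightOneSpectrum (𝓞 ℚ), localEulerPoincareCharacteristic (v.adicCompletion ℚ))
    (v₃ : HeightOneSpectrum (𝓞 ℚ)) (hv₃ : ((3 : ℕ) : 𝓞 ℚ) ∈ v₃.asIdeal)
    (hPort : KatoKuriharaPortThreeAt W 0 v₃)
    -- the CERTIFICATE: THREE VALUES (EVIDENCE, two sources each — sibling file docstring / index)
    (hδ : ∃ (ψ : (ℓ : ℕ) → (ZMod ℓ)ˣ →* Multiplicative (ZMod (3 ^ 1)))
        (ψ₂₇ : (ℓ : ℕ) → (ZMod ℓ)ˣ →* Multiplicative (ZMod (3 ^ 3))),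
      (∀ ℓ ∈ (259 : ℕ).primeFactors, Function.Surjective (ψ ℓ)) ∧
        kuriharaNumber D.f (3 ^ 1) 259 ψ ≠ 0 ∧ kuriharaNumber D.f (3 ^ 1) 1 ψ = 0 ∧
        kuriharaNumber D.f (3 ^ 3) 1 ψ₂₇ ≠ 0) :
    BSDp W 3 := by
  have hI : integralModelInt W = ⟨0, 0, 0, 1344237, -1275542062⟩ := by
    subst hW
    exact integralModelInt_eq_of_map_eq _ (map_mk_int 0 0 0 1344237 (-1275542062))
  exact bsdp3_endm1_v13680be1_of_baseRigidity hKatoS hDel hGZK hmod hmodD hKatoχ h26 hCT hI hr D hopt inv hperf hsum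
    hcompl hEP v₃ hv₃ hPort hδ

/-! ### [S24]-free twin: `15102c1` (`N = 15102`, (M); level `n = 13·19 = 247`; sibling `X4ThreeKuriharaEndM1Records12`) -/

/-- **END-m1 RECORD `15102c1` at `n = 13·19 = 247`, [S24]-FREE (CLOSES NOTHING, moves no mark)** — the twin of the landed
`bsdp3_endm1_v15102c1` (X4ThreeKuriharaEndM1Records12) with the interim NAMED FACT `hS24` and the binder `hunro` DELETED: injectivity at the core
vertex `∅` is n1011-p11's BASE RIGIDITY (R1-58) through n1011-p09's `…_of_baseRigidity` END-m1 and n1011-p18's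
`Assembly.bsdp_three_potMult_of_levelOneCertificates_of_baseRigidity`. So on this row the LOWER half of `BSD(E,3)` carries NO [S24] fact and
NO four-class Chebotarev step; what REMAINS ASSUMED: the PORT `hPort` (FLAG `K22-Thm3.13-PORT@3`), the PT family
`inv hperf hsum hcompl` + `hEP`, `hCT`, the UPPER-half named facts, `hr`, the optimal datum `D`/`hopt`, and the THREE Kurihara
VALUES in `hδ` (EVIDENCE, two sources per value — the sibling record's docstring / `ENDM1-RECORDS-INDEX.tsv`). Kernel inputs by
name: `natCard_threeTorsion_v15102c1`, `isKolyvaginProduct_one_v15102c1`, `forall_card_torsion_le_v15102c1`, `surj3_v15102c1`,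
`tamagawaProduct_v15102c1`. CERTIFICATE-EVIDENCE record SHAPE; nothing booked; no class closed.
[cite: Kim2022StructureSelmer, Thm. 1.9 (6) and Thm. 3.13] [cite: Rubin2011, Thm. 2.8.4]
[cite: Kato2004Asterisque, Thm. 14.5 (3) (p. 236)] [cite: AgasheRibetStein2006, Thm. 2.6 (p. 619)] -/
theorem bsdp3_endm1_v15102c1_of_baseRigidity
    -- UPPER half: the X4 chain of record; GZK; modularity; ARS 2.6; Cassels–Tate (NO [S24] fact)
    (hKatoS : Kato2004.rankZero_padicValNat_sha_le_sub_localTamagawa_of_additive_potGood_of_imageContainsSL2)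
    (hDel : Delbourgo1998.prop4_rankZero_pow_dvd_constantCoeff)
    (hGZK : rank_eq_analyticRank_of_analyticRank_le_one) (hmod : hasEntireLFunction_rat)
    (hmodD : nonempty_modularParametrizationData)
    (hKatoχ : Wuthrich2014.kato_halfEigenCharIdeal_dvd_cyclotomicPrime_of_surjective)
    (h26 : cremona_abs_maninConstant_eq_one_of_level_le)
    (hCT : exists_casselsTate_pairing (K := ℚ))
    -- the row
    {W : WeierstrassCurve ℚ} [W.IsElliptic] [W.IsGloballyMinimal]
    (hI : integralModelInt W = ⟨1, -1, 0, -17204004, -30786110384⟩)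
    (hr : W.analyticRank = 0)
    (D : ModularParametrizationData W 15102)
    (hopt : ∀ z ∈ D.L.lattice, ∃ w ∈ periodLattice D.f, z = D.c * w)
    -- LOWER half: the Poitou–Tate family at `3` (NO `hunro`), Tate's local Euler characteristic, the ONE port
    (inv : LocalInvariants ℚ 3) (hperf : inv.IsPerfect) (hsum : inv.SumLocalTermEqZero)
    (hcompl : inv.SelmerComplement)
    (hEP : ∀ v : HeightOneSpectrum (𝓞 ℚ), localEulerPoincareCharacteristic (v.adicCompletion ℚ))
    (v₃ : HeightOneSpectrum (𝓞 ℚ)) (hv₃ : ((3 : ℕ) : 𝓞 ℚ) ∈ v₃.asIdeal)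
    (hPort : KatoKuriharaPortThreeAt W 0 v₃)
    -- the CERTIFICATE: THREE VALUES (EVIDENCE, two sources each — sibling file docstring / index)
    (hδ : ∃ (ψ : (ℓ : ℕ) → (ZMod ℓ)ˣ →* Multiplicative (ZMod (3 ^ 1)))
        (ψ₂₇ : (ℓ : ℕ) → (ZMod ℓ)ˣ →* Multiplicative (ZMod (3 ^ 3))),
      (∀ ℓ ∈ (247 : ℕ).primeFactors, Function.Surjective (ψ ℓ)) ∧
        kuriharaNumber D.f (3 ^ 1) 247 ψ ≠ 0 ∧ kuriharaNumber D.f (3 ^ 1) 1 ψ = 0 ∧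
        kuriharaNumber D.f (3 ^ 3) 1 ψ₂₇ ≠ 0) :
    BSDp W 3 := by
  haveI : Fact (Nat.Prime 3) := ⟨Nat.prime_three⟩
  haveI : NeZero (247 : ℕ) := ⟨by norm_num⟩
  obtain ⟨ψ, ψ₂₇, hψ, hcert, hzero₁, hunit₁⟩ := hδ
  have htam : ¬ 3 ∣ W.tamagawaProduct := by rw [tamagawaProduct_v15102c1 hI]; decide
  have hc3 : ¬ 3 ∣ (W.baseChange ℚ_[3]).localTamagawaNumber ℤ_[3] := fun h =>
    htam (h.trans (localTamagawaNumber_padic_dvd_tamagawaProduct W 3))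
  have hsurj : W.HasSurjectiveModNGaloisRep ((3 : ℕ) : ℤ) := by simpa using surj3_v15102c1 hI
  have hjneg : padicValRat 3 W.j < 0 :=
    padicValRat_j_neg_of_intModel hI 3 2 (by decide) (by decide)
  exact Assembly.bsdp_three_potMult_of_levelOneCertificates_of_baseRigidity hKatoS hDel hGZK hmod hmodD
    hKatoχ h26 hCT W hI (by decide +kernel) (by decide +kernel) hsurj hjneg hc3 (natCard_threeTorsion_v15102c1 W hI) hr
    (by norm_num) D hopt inv hperf hsum hcompl hEP v₃ hv₃ hPort 247 (isKolyvaginProduct_one_v15102c1 hI)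
    (forall_card_torsion_le_v15102c1 hI) ψ hψ hcert hzero₁ ψ₂₇ hunit₁

/-- **END-m1 RECORD `15102c1`, [S24]-FREE, on the LITERAL model `W = [1, -1, 0, -17204004, -30786110384]`** (pilot pattern: `hI` from `hW`; then
`bsdp3_endm1_v15102c1_of_baseRigidity`). Same hypotheses / EVIDENCE binders / framing; CLOSES NOTHING, nothing booked.
[cite: Kim2022StructureSelmer, Thm. 1.9 (6) and Thm. 3.13] [cite: SilvermanAEC2009, VII.1 Remark 1.1] -/
theorem bsdp3_endm1_v15102c1_of_eq_of_baseRigidity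
    -- UPPER half: the X4 chain of record; GZK; modularity; ARS 2.6; Cassels–Tate (NO [S24] fact)
    (hKatoS : Kato2004.rankZero_padicValNat_sha_le_sub_localTamagawa_of_additive_potGood_of_imageContainsSL2)
    (hDel : Delbourgo1998.prop4_rankZero_pow_dvd_constantCoeff)
    (hGZK : rank_eq_analyticRank_of_analyticRank_le_one) (hmod : hasEntireLFunction_rat)
    (hmodD : nonempty_modularParametrizationData)
    (hKatoχ : Wuthrich2014.kato_halfEigenCharIdeal_dvd_cyclotomicPrime_of_surjective)
    (h26 : cremona_abs_maninConstant_eq_one_of_level_le)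
    (hCT : exists_casselsTate_pairing (K := ℚ))
    -- the row (LITERAL model)
    (W : WeierstrassCurve ℚ) [W.IsElliptic] [W.IsGloballyMinimal]
    (hW : W = ⟨1, -1, 0, -17204004, -30786110384⟩)
    (hr : W.analyticRank = 0)
    (D : ModularParametrizationData W 15102)
    (hopt : ∀ z ∈ D.L.lattice, ∃ w ∈ periodLattice D.f, z = D.c * w)
    -- LOWER half: the Poitou–Tate family at `3` (NO `hunro`), Tate's local Euler characteristic, the ONE port
    (inv : LocalInvariants ℚ 3) (hperf : inv.IsPerfect) (hsum : inv.SumLocalTermEqZero)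
    (hcompl : inv.SelmerComplement)
    (hEP : ∀ v : HeightOneSpectrum (𝓞 ℚ), localEulerPoincareCharacteristic (v.adicCompletion ℚ))
    (v₃ : HeightOneSpectrum (𝓞 ℚ)) (hv₃ : ((3 : ℕ) : 𝓞 ℚ) ∈ v₃.asIdeal)
    (hPort : KatoKuriharaPortThreeAt W 0 v₃)
    -- the CERTIFICATE: THREE VALUES (EVIDENCE, two sources each — sibling file docstring / index)
    (hδ : ∃ (ψ : (ℓ : ℕ) → (ZMod ℓ)ˣ →* Multiplicative (ZMod (3 ^ 1)))
        (ψ₂₇ : (ℓ : ℕ) → (ZMod ℓ)ˣ →* Multiplicative (ZMod (3 ^ 3))),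
      (∀ ℓ ∈ (247 : ℕ).primeFactors, Function.Surjective (ψ ℓ)) ∧
        kuriharaNumber D.f (3 ^ 1) 247 ψ ≠ 0 ∧ kuriharaNumber D.f (3 ^ 1) 1 ψ = 0 ∧
        kuriharaNumber D.f (3 ^ 3) 1 ψ₂₇ ≠ 0) :
    BSDp W 3 := by
  have hI : integralModelInt W = ⟨1, -1, 0, -17204004, -30786110384⟩ := by
    subst hW
    exact integralModelInt_eq_of_map_eq _ (map_mk_int 1 (-1) 0 (-17204004) (-30786110384))
  exact bsdp3_endm1_v15102c1_of_baseRigidity hKatoS hDel hGZK hmod hmodD hKatoχ h26 hCT hI hr D hopt inv hperf hsum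
    hcompl hEP v₃ hv₃ hPort hδ

/-! ### [S24]-free twin: `15129e1` (`N = 15129`, (M); level `n = 7·43 = 301`; sibling `X4ThreeKuriharaEndM1Records12`) -/

/-- **END-m1 RECORD `15129e1` at `n = 7·43 = 301`, [S24]-FREE (CLOSES NOTHING, moves no mark)** — the twin of the landed
`bsdp3_endm1_v15129e1` (X4ThreeKuriharaEndM1Records12) with the interim NAMED FACT `hS24` and the binder `hunro` DELETED: injectivity at the core
vertex `∅` is n1011-p11's BASE RIGIDITY (R1-58) through n1011-p09's `…_of_baseRigidity` END-m1 and n1011-p18's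
`Assembly.bsdp_three_potMult_of_levelOneCertificates_of_baseRigidity`. So on this row the LOWER half of `BSD(E,3)` carries NO [S24] fact and
NO four-class Chebotarev step; what REMAINS ASSUMED: the PORT `hPort` (FLAG `K22-Thm3.13-PORT@3`), the PT family
`inv hperf hsum hcompl` + `hEP`, `hCT`, the UPPER-half named facts, `hr`, the optimal datum `D`/`hopt`, and the THREE Kurihara
VALUES in `hδ` (EVIDENCE, two sources per value — the sibling record's docstring / `ENDM1-RECORDS-INDEX.tsv`). Kernel inputs by
name: `natCard_threeTorsion_v15129e1`, `isKolyvaginProduct_one_v15129e1`, `forall_card_torsion_le_v15129e1`, `surj3_v15129e1`,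
`tamagawaProduct_v15129e1`. CERTIFICATE-EVIDENCE record SHAPE; nothing booked; no class closed.
[cite: Kim2022StructureSelmer, Thm. 1.9 (6) and Thm. 3.13] [cite: Rubin2011, Thm. 2.8.4]
[cite: Kato2004Asterisque, Thm. 14.5 (3) (p. 236)] [cite: AgasheRibetStein2006, Thm. 2.6 (p. 619)] -/
theorem bsdp3_endm1_v15129e1_of_baseRigidity
    -- UPPER half: the X4 chain of record; GZK; modularity; ARS 2.6; Cassels–Tate (NO [S24] fact)
    (hKatoS : Kato2004.rankZero_padicValNat_sha_le_sub_localTamagawa_of_additive_potGood_of_imageContainsSL2)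
    (hDel : Delbourgo1998.prop4_rankZero_pow_dvd_constantCoeff)
    (hGZK : rank_eq_analyticRank_of_analyticRank_le_one) (hmod : hasEntireLFunction_rat)
    (hmodD : nonempty_modularParametrizationData)
    (hKatoχ : Wuthrich2014.kato_halfEigenCharIdeal_dvd_cyclotomicPrime_of_surjective)
    (h26 : cremona_abs_maninConstant_eq_one_of_level_le)
    (hCT : exists_casselsTate_pairing (K := ℚ))
    -- the row
    {W : WeierstrassCurve ℚ} [W.IsElliptic] [W.IsGloballyMinimal]
    (hI : integralModelInt W = ⟨0, 0, 1, -156333, -25414619⟩)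
    (hr : W.analyticRank = 0)
    (D : ModularParametrizationData W 15129)
    (hopt : ∀ z ∈ D.L.lattice, ∃ w ∈ periodLattice D.f, z = D.c * w)
    -- LOWER half: the Poitou–Tate family at `3` (NO `hunro`), Tate's local Euler characteristic, the ONE port
    (inv : LocalInvariants ℚ 3) (hperf : inv.IsPerfect) (hsum : inv.SumLocalTermEqZero)
    (hcompl : inv.SelmerComplement)
    (hEP : ∀ v : HeightOneSpectrum (𝓞 ℚ), localEulerPoincareCharacteristic (v.adicCompletion ℚ))
    (v₃ : HeightOneSpectrum (𝓞 ℚ)) (hv₃ : ((3 : ℕ) : 𝓞 ℚ) ∈ v₃.asIdeal)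
    (hPort : KatoKuriharaPortThreeAt W 0 v₃)
    -- the CERTIFICATE: THREE VALUES (EVIDENCE, two sources each — sibling file docstring / index)
    (hδ : ∃ (ψ : (ℓ : ℕ) → (ZMod ℓ)ˣ →* Multiplicative (ZMod (3 ^ 1)))
        (ψ₂₇ : (ℓ : ℕ) → (ZMod ℓ)ˣ →* Multiplicative (ZMod (3 ^ 3))),
      (∀ ℓ ∈ (301 : ℕ).primeFactors, Function.Surjective (ψ ℓ)) ∧
        kuriharaNumber D.f (3 ^ 1) 301 ψ ≠ 0 ∧ kuriharaNumber D.f (3 ^ 1) 1 ψ = 0 ∧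
        kuriharaNumber D.f (3 ^ 3) 1 ψ₂₇ ≠ 0) :
    BSDp W 3 := by
  haveI : Fact (Nat.Prime 3) := ⟨Nat.prime_three⟩
  haveI : NeZero (301 : ℕ) := ⟨by norm_num⟩
  obtain ⟨ψ, ψ₂₇, hψ, hcert, hzero₁, hunit₁⟩ := hδ
  have htam : ¬ 3 ∣ W.tamagawaProduct := by rw [tamagawaProduct_v15129e1 hI]; decide
  have hc3 : ¬ 3 ∣ (W.baseChange ℚ_[3]).localTamagawaNumber ℤ_[3] := fun h =>
    htam (h.trans (localTamagawaNumber_padic_dvd_tamagawaProduct W 3))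
  have hsurj : W.HasSurjectiveModNGaloisRep ((3 : ℕ) : ℤ) := by simpa using surj3_v15129e1 hI
  have hjneg : padicValRat 3 W.j < 0 :=
    padicValRat_j_neg_of_intModel hI 3 2 (by decide) (by decide)
  exact Assembly.bsdp_three_potMult_of_levelOneCertificates_of_baseRigidity hKatoS hDel hGZK hmod hmodD
    hKatoχ h26 hCT W hI (by decide +kernel) (by decide +kernel) hsurj hjneg hc3 (natCard_threeTorsion_v15129e1 W hI) hr
    (by norm_num) D hopt inv hperf hsum hcompl hEP v₃ hv₃ hPort 301 (isKolyvaginProduct_one_v15129e1 hI)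
    (forall_card_torsion_le_v15129e1 hI) ψ hψ hcert hzero₁ ψ₂₇ hunit₁

/-- **END-m1 RECORD `15129e1`, [S24]-FREE, on the LITERAL model `W = [0, 0, 1, -156333, -25414619]`** (pilot pattern: `hI` from `hW`; then
`bsdp3_endm1_v15129e1_of_baseRigidity`). Same hypotheses / EVIDENCE binders / framing; CLOSES NOTHING, nothing booked.
[cite: Kim2022StructureSelmer, Thm. 1.9 (6) and Thm. 3.13] [cite: SilvermanAEC2009, VII.1 Remark 1.1] -/
theorem bsdp3_endm1_v15129e1_of_eq_of_baseRigidity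
    -- UPPER half: the X4 chain of record; GZK; modularity; ARS 2.6; Cassels–Tate (NO [S24] fact)
    (hKatoS : Kato2004.rankZero_padicValNat_sha_le_sub_localTamagawa_of_additive_potGood_of_imageContainsSL2)
    (hDel : Delbourgo1998.prop4_rankZero_pow_dvd_constantCoeff)
    (hGZK : rank_eq_analyticRank_of_analyticRank_le_one) (hmod : hasEntireLFunction_rat)
    (hmodD : nonempty_modularParametrizationData)
    (hKatoχ : Wuthrich2014.kato_halfEigenCharIdeal_dvd_cyclotomicPrime_of_surjective)
    (h26 : cremona_abs_maninConstant_eq_one_of_level_le)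
    (hCT : exists_casselsTate_pairing (K := ℚ))
    -- the row (LITERAL model)
    (W : WeierstrassCurve ℚ) [W.IsElliptic] [W.IsGloballyMinimal]
    (hW : W = ⟨0, 0, 1, -156333, -25414619⟩)
    (hr : W.analyticRank = 0)
    (D : ModularParametrizationData W 15129)
    (hopt : ∀ z ∈ D.L.lattice, ∃ w ∈ periodLattice D.f, z = D.c * w)
    -- LOWER half: the Poitou–Tate family at `3` (NO `hunro`), Tate's local Euler characteristic, the ONE port
    (inv : LocalInvariants ℚ 3) (hperf : inv.IsPerfect) (hsum : inv.SumLocalTermEqZero)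
    (hcompl : inv.SelmerComplement)
    (hEP : ∀ v : HeightOneSpectrum (𝓞 ℚ), localEulerPoincareCharacteristic (v.adicCompletion ℚ))
    (v₃ : HeightOneSpectrum (𝓞 ℚ)) (hv₃ : ((3 : ℕ) : 𝓞 ℚ) ∈ v₃.asIdeal)
    (hPort : KatoKuriharaPortThreeAt W 0 v₃)
    -- the CERTIFICATE: THREE VALUES (EVIDENCE, two sources each — sibling file docstring / index)
    (hδ : ∃ (ψ : (ℓ : ℕ) → (ZMod ℓ)ˣ →* Multiplicative (ZMod (3 ^ 1)))
        (ψ₂₇ : (ℓ : ℕ) → (ZMod ℓ)ˣ →* Multiplicative (ZMod (3 ^ 3))),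
      (∀ ℓ ∈ (301 : ℕ).primeFactors, Function.Surjective (ψ ℓ)) ∧
        kuriharaNumber D.f (3 ^ 1) 301 ψ ≠ 0 ∧ kuriharaNumber D.f (3 ^ 1) 1 ψ = 0 ∧
        kuriharaNumber D.f (3 ^ 3) 1 ψ₂₇ ≠ 0) :
    BSDp W 3 := by
  have hI : integralModelInt W = ⟨0, 0, 1, -156333, -25414619⟩ := by
    subst hW
    exact integralModelInt_eq_of_map_eq _ (map_mk_int 0 0 1 (-156333) (-25414619))
  exact bsdp3_endm1_v15129e1_of_baseRigidity hKatoS hDel hGZK hmod hmodD hKatoχ h26 hCT hI hr D hopt inv hperf hsum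
    hcompl hEP v₃ hv₃ hPort hδ

end Summit.BirchSwinnertonDyer.Rank1Residual.Additive.X4ThreeKuriharaCert

end
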